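import Mathlib.NumberTheory.Real.Irrational
import Mathlib.Analysis.SpecialFunctions.Log.Basic
import Mathlib.LinearAlgebra.Dimension.Constructions
import Mathlib.RingTheory.Finiteness.Basic
import Literature.NumberTheory.DiophantineApproximation.NesterenkoCriterion
import Literature.NumberTheory.DiophantineApproximation.NesterenkoCriterionTwoRates
import Summits.KontsevichZagierPeriods.Zeta5Search.CriteriaNesterenko
import Summits.KontsevichZagierPeriods.Zeta5Search.CriteriaNesterenkoBrackets
import HarnessLib

/-!
# ζ(5) search — Nesterenko's criterion in PARTIAL dimension: "k of the θ j are irrational"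
# (cell `pub-zeta5`, PROVER 3; criteria for the T2 lane, `s = 7` and `s = 9`)

HONEST FRAMING: systematic search; no irrationality claim unless certified.

`CriteriaNesterenko.lean` / `CriteriaNesterenkoBrackets.lean` use Nesterenko's dimension bound
only in the FULL-dimension case (`dim = card ι` ⇒ every `θ j ∉ ℚ`), which for forms in
`1, ζ(3), ζ(5)` needs the margin `μ₂ = σ - Q > 0`. The Ball–Rivoal / Zudilin / Fischler–Sprang–
Zudilin route to results of the type "at least one of `ζ(5), ζ(7), …` is irrational" uses the bound
in PARTIAL dimension instead: a lower bound `dim_ℚ (ℚ·1 + ∑ ℚ θ j) > k + 1` forces MORE THAN `k` of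
the `θ j` to be irrational, whatever they are. This file types that step and its instances for the
cell's intermediate target **T2** ("one of `ζ(5), ζ(7)`", improving the tree's PROVED `zudilin` =
"one of `ζ(5), ζ(7), ζ(9), ζ(11)`", Zudilin 2001) — all PROVED, no named fact, no `sorry`:

* `finrank_span_range_le_card_add_one` — if `θ j₁ = 1` and `s` contains every index `j` with
  `θ j ∉ ℚ`, then `dim_ℚ span(θ) ≤ card s + 1` (rational `θ j` lie on the line `ℚ · θ j₁`).
* `le_finrank_of_nesterenko_rates` — Nesterenko 1985 (tree, PROVED:
  `…NesterenkoCriterion.nesterenko_criterion`) in the cell's exponent units: integer forms of EXACT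
  size `|L_n|^{1/n} → e^{-σ}` with coefficients `≤ e^{Q' n}` (all `Q' > Q > 0`) give
  `1 + σ/Q ≤ dim`; `le_finrank_of_nesterenko_bracket_rates` — the two-exponent form (tree, PROVED:
  `…nesterenko_criterion_two_rates`): brackets `e^{-σ₁ n} ≲ |L_n| ≲ e^{-σ₂ n}` give
  `(Q + σ₁)/(Q + σ₁ - σ₂) ≤ dim`.
* `exists_finset_irrational_of_nesterenko_margin` — with `θ j₁ = 1`: the PARTIAL MARGIN
  `k · Q < σ` (`k : ℕ`) yields a finset of MORE THAN `k` indices `j` with `θ j` irrational;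
  `exists_finset_irrational_of_nesterenko_brackets` — the same from the bracket margin
  `k (Q + σ₁) < (k + 1) σ₂`.
* Instances, `s = 7`: `zetaFiveOrSeven_of_fourTermForms` — integer forms in `1, ζ(3), ζ(5), ζ(7)`
  (NO elimination of `ζ(3)` needed) with exact rate and margin `Q < σ` give
  `Irrational ζ(5) ∨ Irrational ζ(7)`; NOTE this is the SAME number `μ₂ = σ - Q` that C2 asks of
  three-term forms in `1, ζ(3), ζ(5)` for `ζ(5)` itself — a four-term family pays nothing extra for
  the weaker conclusion T2. `zetaFiveOrSeven_of_fourTermForms_brackets` — bracket margin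
  `Q + σ₁ < 2 σ₂`.
* Instances, `s = 9`: `zetaFiveSevenNine_of_fiveTermForms` — forms in `1, ζ(3), …, ζ(9)`, margin
  `Q < σ` ⇒ one of `ζ(5), ζ(7), ζ(9)` irrational (would improve Zudilin's four to three);
  `twoOf_zetaFiveSevenNine_of_fiveTermForms` — margin `2 Q < σ` ⇒ two of them.

In `CRITERIA.md` units (§0, C2): `σ = c + φ - δ` (size of the integer forms), `Q = b + δ - φ`
(size of their coefficients); the EXACT rate is a limit (Poincaré–Perron for recurrences), the
bracket form takes the ratio boxes of FORMAT A. No forms are constructed here: every theorem is an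
implication the T2 lane measures its margin against.
-/

noncomputable section

open Filter Topology Finset Module
open Literature.NumberTheory.Transcendental
open Literature.NumberTheory.DiophantineApproximation

namespace Summit.KontsevichZagierPeriods.Zeta5Search

/-! ### Counting irrational coordinates from the dimension of the span -/

/-- **Rational coordinates do not add dimension.** If `θ j₁ = 1` and the finset `s` contains every
index `j` with `θ j` irrational, then `dim_ℚ span_ℚ {θ j} ≤ card s + 1`: every rational `θ j = q`
equals `q • θ j₁`, so the span is already spanned by `θ j₁` and the `θ j`, `j ∈ s`. -/
theorem finrank_span_range_le_card_add_one {ι : Type*} (θ : ι → ℝ) {j₁ : ι} (h1 : θ j₁ = 1)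
    (s : Finset ι) (hs : ∀ j, Irrational (θ j) → j ∈ s) :
    finrank ℚ (Submodule.span ℚ (Set.range θ)) ≤ s.card + 1 := by
  classical
  set t : Finset ℝ := (insert j₁ s).image θ with ht
  have hsub : Set.range θ ⊆ (Submodule.span ℚ (t : Set ℝ) : Set ℝ) := by
    rintro _ ⟨j, rfl⟩
    by_cases hj : Irrational (θ j)
    · exact Submodule.subset_span
        (by rw [ht]; exact mem_coe.2 (mem_image_of_mem θ (mem_insert_of_mem (hs j hj))))
    · have hj' : θ j ∈ Set.range ((↑) : ℚ → ℝ) := by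
        unfold Irrational at hj
        push Not at hj
        exact hj
      obtain ⟨q, hq⟩ := hj'
      rw [← hq, ← Rat.smul_one_eq_cast ℝ q, ← h1]
      exact Submodule.smul_mem _ q (Submodule.subset_span (by simp [ht]))
  have hle : Submodule.span ℚ (Set.range θ) ≤ Submodule.span ℚ (t : Set ℝ) :=
    Submodule.span_le.2 hsub
  calc finrank ℚ (Submodule.span ℚ (Set.range θ))
      ≤ finrank ℚ (Submodule.span ℚ (t : Set ℝ)) := Submodule.finrank_mono hle
    _ ≤ t.card := finrank_span_finset_le_card t
    _ ≤ (insert j₁ s).card := card_image_le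
    _ ≤ s.card + 1 := card_insert_le j₁ s

/-- **More than `k` irrational coordinates from `dim > k + 1`.** If `θ j₁ = 1` and
`k + 1 < dim_ℚ span_ℚ {θ j}` (as real numbers), there is a finset of more than `k` indices `j` with
`θ j` irrational. -/
theorem exists_finset_irrational_of_lt_finrank {ι : Type*} [Fintype ι] (θ : ι → ℝ) {j₁ : ι}
    (h1 : θ j₁ = 1) (k : ℕ)
    (hdim : (k : ℝ) + 1 < (finrank ℚ (Submodule.span ℚ (Set.range θ)) : ℝ)) :
    ∃ s : Finset ι, k < s.card ∧ ∀ j ∈ s, Irrational (θ j) := by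
  classical
  refine ⟨univ.filter fun j => Irrational (θ j), ?_, fun j hj => (mem_filter.1 hj).2⟩
  have h := finrank_span_range_le_card_add_one θ h1 (univ.filter fun j => Irrational (θ j))
    (fun j hj => mem_filter.2 ⟨mem_univ j, hj⟩)
  have h' : ((finrank ℚ (Submodule.span ℚ (Set.range θ)) : ℕ) : ℝ) ≤
      ((univ.filter fun j => Irrational (θ j)).card : ℝ) + 1 := by exact_mod_cast h
  have h'' : (k : ℝ) < ((univ.filter fun j => Irrational (θ j)).card : ℝ) := by linarith
  exact_mod_cast h''

/-! ### Nesterenko's dimension bound in the cell's exponent units -/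

/-- Coefficient bounds `|p n j| ≤ e^{Q' n}` for every `Q' > Q` are the hypothesis
`|p n j| ≤ β'^n` for every `β' > β = e^Q` of the tree's `nesterenko_criterion`. -/
theorem eventually_coeff_le_pow_of_exp_rates {ι : Type*} (p : ℕ → ι → ℤ) {Q : ℝ}
    (hp : ∀ Q' : ℝ, Q < Q' → ∀ᶠ n : ℕ in atTop, ∀ j, |(p n j : ℝ)| ≤ Real.exp (Q' * n)) :
    ∀ β' : ℝ, Real.exp Q < β' → ∀ᶠ n : ℕ in atTop, ∀ j, |(p n j : ℝ)| ≤ β' ^ n := by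
  intro β' hβ'
  have hβ'0 : 0 < β' := (Real.exp_pos Q).trans hβ'
  have hQ' : Q < Real.log β' := by rw [Real.lt_log_iff_exp_lt hβ'0]; exact hβ'
  filter_upwards [hp (Real.log β') hQ'] with n hn j
  have e : Real.exp (Real.log β' * n) = β' ^ n := by
    rw [mul_comm, Real.exp_nat_mul, Real.exp_log hβ'0]
  rw [← e]; exact hn j

/-- **Nesterenko 1985 in exponent units.** Integer forms `L_n = ∑ j, p n j θ j` of EXACT size
`|L_n|^{1/n} → e^{-σ}` (`σ > 0`) with coefficients `|p n j| ≤ e^{Q' n}` eventually for every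
`Q' > Q` (`Q > 0`) give `1 + σ/Q ≤ dim_ℚ span_ℚ {θ j}` (tree: `nesterenko_criterion`, PROVED). -/
theorem le_finrank_of_nesterenko_rates {ι : Type*} [Fintype ι] (θ : ι → ℝ) (p : ℕ → ι → ℤ)
    {σ Q : ℝ} (hσ : 0 < σ) (hQ : 0 < Q)
    (hp : ∀ Q' : ℝ, Q < Q' → ∀ᶠ n : ℕ in atTop, ∀ j, |(p n j : ℝ)| ≤ Real.exp (Q' * n))
    (hℓ : Tendsto (fun n : ℕ => |∑ j, (p n j : ℝ) * θ j| ^ (1 / (n : ℝ))) atTop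
      (𝓝 (Real.exp (-σ)))) :
    1 + σ / Q ≤ (finrank ℚ (Submodule.span ℚ (Set.range θ)) : ℝ) := by
  have hα : 0 < Real.exp (-σ) := Real.exp_pos _
  have hα1 : Real.exp (-σ) < 1 := Real.exp_lt_one_iff.2 (by linarith)
  have hβ : 1 < Real.exp Q := Real.one_lt_exp_iff.2 hQ
  have h := NesterenkoCriterion.nesterenko_criterion θ p hα hα1 hβ
    (eventually_coeff_le_pow_of_exp_rates p hp) hℓ
  rw [Real.log_exp, Real.log_exp, neg_div, sub_neg_eq_add] at h
  exact h

/-- **Nesterenko's two-exponent criterion in exponent units.** Integer forms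
`L_n = ∑ j, p n j θ j` with coefficients `|p n j| ≤ e^{Q' n}` eventually for every `Q' > Q`
(`Q > 0`), `|L_n| ≤ e^{-s n}` eventually for every `s < σ₂` and `e^{-s n} ≤ |L_n|` eventually for
every `s > σ₁` (`0 < σ₂ ≤ σ₁`) give `(Q + σ₁)/(Q + σ₁ - σ₂) ≤ dim_ℚ span_ℚ {θ j}` (tree:
`nesterenko_criterion_two_rates`, PROVED). -/
theorem le_finrank_of_nesterenko_bracket_rates {ι : Type*} [Fintype ι] (θ : ι → ℝ)
    (p : ℕ → ι → ℤ) {σ₁ σ₂ Q : ℝ} (hσ₂ : 0 < σ₂) (hσ₁₂ : σ₂ ≤ σ₁) (hQ : 0 < Q)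
    (hp : ∀ Q' : ℝ, Q < Q' → ∀ᶠ n : ℕ in atTop, ∀ j, |(p n j : ℝ)| ≤ Real.exp (Q' * n))
    (hup : ∀ s : ℝ, s < σ₂ → ∀ᶠ n : ℕ in atTop, |∑ j, (p n j : ℝ) * θ j| ≤ Real.exp (-(s * n)))
    (hlow : ∀ s : ℝ, σ₁ < s → ∀ᶠ n : ℕ in atTop, Real.exp (-(s * n)) ≤ |∑ j, (p n j : ℝ) * θ j|) :
    (Q + σ₁) / (Q + σ₁ - σ₂) ≤ (finrank ℚ (Submodule.span ℚ (Set.range θ)) : ℝ) := by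
  set α₁ : ℝ := Real.exp (-σ₁) with hα₁def
  set α₂ : ℝ := Real.exp (-σ₂) with hα₂def
  set β : ℝ := Real.exp Q with hβdef
  have hα₁ : 0 < α₁ := Real.exp_pos _
  have hα₁₂ : α₁ ≤ α₂ := Real.exp_le_exp.2 (by linarith)
  have hα₂1 : α₂ < 1 := Real.exp_lt_one_iff.2 (by linarith)
  have hβ : 1 < β := Real.one_lt_exp_iff.2 hQ
  -- upper bracket: for `a > α₂` pick `s` with `-log a < s < σ₂`
  have hup' : ∀ a : ℝ, α₂ < a → ∀ᶠ n : ℕ in atTop, |∑ j, (p n j : ℝ) * θ j| < a ^ n := by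
    intro a ha
    have ha0 : 0 < a := (Real.exp_pos _).trans ha
    have hlog : -Real.log a < σ₂ := by
      have := Real.log_lt_log (Real.exp_pos _) ha
      rw [Real.log_exp] at this; linarith
    obtain ⟨s, hs1, hs2⟩ := exists_between hlog
    filter_upwards [hup s hs2, eventually_ge_atTop 1] with n hn hn1
    refine hn.trans_lt ?_
    have e : a ^ n = Real.exp (Real.log a * n) := by
      rw [mul_comm, Real.exp_nat_mul, Real.exp_log ha0]
    rw [e, Real.exp_lt_exp]
    have hn1' : (1 : ℝ) ≤ n := by exact_mod_cast hn1
    nlinarith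
  -- lower bracket: for `0 ≤ a < α₁` pick `s` with `σ₁ < s < -log a` (any `s > σ₁` if `a = 0`)
  have hlow' : ∀ a : ℝ, 0 ≤ a → a < α₁ →
      ∀ᶠ n : ℕ in atTop, a ^ n < |∑ j, (p n j : ℝ) * θ j| := by
    intro a ha0 ha
    rcases ha0.eq_or_lt with rfl | ha0'
    · filter_upwards [hlow (σ₁ + 1) (by linarith), eventually_ge_atTop 1] with n hn hn1
      rw [zero_pow (by omega)]
      exact (Real.exp_pos _).trans_le hn
    · have hlog : σ₁ < -Real.log a := by
        have := Real.log_lt_log ha0' ha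
        rw [Real.log_exp] at this; linarith
      obtain ⟨s, hs1, hs2⟩ := exists_between hlog
      filter_upwards [hlow s hs1, eventually_ge_atTop 1] with n hn hn1
      refine lt_of_lt_of_le ?_ hn
      have e : a ^ n = Real.exp (Real.log a * n) := by
        rw [mul_comm, Real.exp_nat_mul, Real.exp_log ha0']
      rw [e, Real.exp_lt_exp]
      have hn1' : (1 : ℝ) ≤ n := by exact_mod_cast hn1
      nlinarith
  have h := NesterenkoCriterion.nesterenko_criterion_two_rates θ p hα₁ hα₁₂ hα₂1 hβ
    (eventually_coeff_le_pow_of_exp_rates p hp) hup' hlow'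
  simp only [hα₁def, hα₂def, hβdef, Real.log_exp] at h
  have e : Q + -σ₂ - -σ₁ = Q + σ₁ - σ₂ := by ring
  have e' : Q - -σ₁ = Q + σ₁ := by ring
  rw [e, e'] at h
  exact h

/-! ### The partial-dimension margins -/

/-- **Partial margin `k · Q < σ` ⇒ more than `k` of the `θ j` are irrational.** Let `θ : ι → ℝ`
with `θ j₁ = 1` and integer forms `L_n = ∑ j, p n j θ j` of EXACT size `|L_n|^{1/n} → e^{-σ}`
(`σ > 0`), coefficients `|p n j| ≤ e^{Q' n}` eventually for every `Q' > Q` (`Q > 0`). If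
`k · Q < σ` (`k : ℕ`), then there is a finset of more than `k` indices `j` with `θ j` irrational.
(`k = card ι - 2` is the full-independence margin of `irrational_of_nesterenko_margin`; `k = 0`
is the elementary "one of".) -/
theorem exists_finset_irrational_of_nesterenko_margin {ι : Type*} [Fintype ι] (θ : ι → ℝ)
    (j₁ : ι) (h1 : θ j₁ = 1) (p : ℕ → ι → ℤ) {σ Q : ℝ} (hσ : 0 < σ) (hQ : 0 < Q)
    (hp : ∀ Q' : ℝ, Q < Q' → ∀ᶠ n : ℕ in atTop, ∀ j, |(p n j : ℝ)| ≤ Real.exp (Q' * n))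
    (hℓ : Tendsto (fun n : ℕ => |∑ j, (p n j : ℝ) * θ j| ^ (1 / (n : ℝ))) atTop
      (𝓝 (Real.exp (-σ))))
    (k : ℕ) (hmargin : (k : ℝ) * Q < σ) :
    ∃ s : Finset ι, k < s.card ∧ ∀ j ∈ s, Irrational (θ j) := by
  refine exists_finset_irrational_of_lt_finrank θ h1 k ?_
  have h := le_finrank_of_nesterenko_rates θ p hσ hQ hp hℓ
  have hk : (k : ℝ) < σ / Q := by rw [lt_div_iff₀ hQ]; exact hmargin
  linarith

/-- **Bracket partial margin `k (Q + σ₁) < (k + 1) σ₂` ⇒ more than `k` of the `θ j` are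
irrational.** As `exists_finset_irrational_of_nesterenko_margin`, with decay BRACKETS
(`|L_n| ≤ e^{-s n}` eventually for all `s < σ₂`, `e^{-s n} ≤ |L_n|` eventually for all `s > σ₁`,
`0 < σ₂ ≤ σ₁`) instead of an exact rate; for `σ₁ = σ₂ = σ` the margin is `k · Q < σ`. -/
theorem exists_finset_irrational_of_nesterenko_brackets {ι : Type*} [Fintype ι] (θ : ι → ℝ)
    (j₁ : ι) (h1 : θ j₁ = 1) (p : ℕ → ι → ℤ) {σ₁ σ₂ Q : ℝ} (hσ₂ : 0 < σ₂) (hσ₁₂ : σ₂ ≤ σ₁)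
    (hQ : 0 < Q)
    (hp : ∀ Q' : ℝ, Q < Q' → ∀ᶠ n : ℕ in atTop, ∀ j, |(p n j : ℝ)| ≤ Real.exp (Q' * n))
    (hup : ∀ s : ℝ, s < σ₂ → ∀ᶠ n : ℕ in atTop, |∑ j, (p n j : ℝ) * θ j| ≤ Real.exp (-(s * n)))
    (hlow : ∀ s : ℝ, σ₁ < s → ∀ᶠ n : ℕ in atTop, Real.exp (-(s * n)) ≤ |∑ j, (p n j : ℝ) * θ j|)
    (k : ℕ) (hmargin : (k : ℝ) * (Q + σ₁) < (k + 1) * σ₂) :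
    ∃ s : Finset ι, k < s.card ∧ ∀ j ∈ s, Irrational (θ j) := by
  refine exists_finset_irrational_of_lt_finrank θ h1 k ?_
  have h := le_finrank_of_nesterenko_bracket_rates θ p hσ₂ hσ₁₂ hQ hp hup hlow
  have hden : 0 < Q + σ₁ - σ₂ := by linarith
  have hk : (k : ℝ) + 1 < (Q + σ₁) / (Q + σ₁ - σ₂) := by
    rw [lt_div_iff₀ hden]; nlinarith
  linarith

/-! ### Instances, `s = 7`: forms in `1, ζ(3), ζ(5), ζ(7)` and the target T2 -/

/-- From "more than one of the coordinates `j ∈ {1, 2, 3}` of `![1, ζ(3), ζ(5), ζ(7)]` is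
irrational" to "one of `ζ(5), ζ(7)` is irrational" (the coordinate `0` is rational). -/
private theorem zetaFiveOrSeven_of_finset (s : Finset (Fin 4)) (hcard : 1 < s.card)
    (hs : ∀ j ∈ s, Irrational ((![(1 : ℝ), zetaValue 3, zetaValue 5, zetaValue 7]) j)) :
    Irrational (zetaValue 5) ∨ Irrational (zetaValue 7) := by
  by_contra hcon
  push Not at hcon
  have hsub : s ⊆ {1} := by
    intro j hj
    have hj' := hs j hj
    fin_cases j
    · simp at hj'
    · simp
    · exact absurd (by simpa using hj') hcon.1
    · exact absurd (by simpa using hj') hcon.2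
  have h := card_le_card hsub
  rw [card_singleton] at h
  omega

/-- **T2 from four-term forms in `1, ζ(3), ζ(5), ζ(7)` (exact rate).** Integer forms
`L_n = p n 0 + p n 1 ζ(3) + p n 2 ζ(5) + p n 3 ζ(7)` of EXACT size `|L_n|^{1/n} → e^{-σ}` with
coefficients `|p n j| ≤ e^{Q' n}` eventually for every `Q' > Q > 0`, and the margin `Q < σ`: then
`dim_ℚ (ℚ + ℚζ(3) + ℚζ(5) + ℚζ(7)) ≥ 3`, so two of `ζ(3), ζ(5), ζ(7)` are irrational, hence AT
LEAST ONE OF `ζ(5), ζ(7)` is irrational. No elimination of `ζ(3)` is required, and the margin is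
the same number `σ - Q` as C2's full-independence margin `μ₂` for three-term forms in
`1, ζ(3), ζ(5)`. (Implication only; no such forms are known — Zudilin's record is one of
`ζ(5), …, ζ(11)`.) -/
theorem zetaFiveOrSeven_of_fourTermForms (p : ℕ → Fin 4 → ℤ) {σ Q : ℝ} (hσ : 0 < σ)
    (hQ : 0 < Q)
    (hp : ∀ Q' : ℝ, Q < Q' → ∀ᶠ n : ℕ in atTop, ∀ j, |(p n j : ℝ)| ≤ Real.exp (Q' * n))
    (hℓ : Tendsto (fun n : ℕ => |(p n 0 : ℝ) + p n 1 * zetaValue 3 + p n 2 * zetaValue 5 +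
      p n 3 * zetaValue 7| ^ (1 / (n : ℝ))) atTop (𝓝 (Real.exp (-σ))))
    (hmargin : Q < σ) :
    Irrational (zetaValue 5) ∨ Irrational (zetaValue 7) := by
  set θ : Fin 4 → ℝ := ![(1 : ℝ), zetaValue 3, zetaValue 5, zetaValue 7] with hθ
  have hsum : ∀ n : ℕ, ∑ j, (p n j : ℝ) * θ j =
      (p n 0 : ℝ) + p n 1 * zetaValue 3 + p n 2 * zetaValue 5 + p n 3 * zetaValue 7 := by
    intro n
    simp [hθ, Fin.sum_univ_four]
  have hℓ' : Tendsto (fun n : ℕ => |∑ j, (p n j : ℝ) * θ j| ^ (1 / (n : ℝ))) atTop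
      (𝓝 (Real.exp (-σ))) := hℓ.congr fun n => by rw [hsum n]
  obtain ⟨s, hcard, hs⟩ := exists_finset_irrational_of_nesterenko_margin θ 0 (by simp [hθ]) p
    hσ hQ hp hℓ' 1 (by simpa using hmargin)
  exact zetaFiveOrSeven_of_finset s hcard (by simpa [hθ] using hs)

/-- **T2 from four-term forms in `1, ζ(3), ζ(5), ζ(7)` (decay brackets).** As
`zetaFiveOrSeven_of_fourTermForms` with `|L_n| ≤ e^{-s n}` eventually for every `s < σ₂` and
`e^{-s n} ≤ |L_n|` eventually for every `s > σ₁` (`0 < σ₂ ≤ σ₁`) in place of the exact rate, and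
the bracket margin `Q + σ₁ < 2 σ₂`: then at least one of `ζ(5), ζ(7)` is irrational. -/
theorem zetaFiveOrSeven_of_fourTermForms_brackets (p : ℕ → Fin 4 → ℤ) {σ₁ σ₂ Q : ℝ}
    (hσ₂ : 0 < σ₂) (hσ₁₂ : σ₂ ≤ σ₁) (hQ : 0 < Q)
    (hp : ∀ Q' : ℝ, Q < Q' → ∀ᶠ n : ℕ in atTop, ∀ j, |(p n j : ℝ)| ≤ Real.exp (Q' * n))
    (hup : ∀ s : ℝ, s < σ₂ → ∀ᶠ n : ℕ in atTop, |(p n 0 : ℝ) + p n 1 * zetaValue 3 +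
      p n 2 * zetaValue 5 + p n 3 * zetaValue 7| ≤ Real.exp (-(s * n)))
    (hlow : ∀ s : ℝ, σ₁ < s → ∀ᶠ n : ℕ in atTop, Real.exp (-(s * n)) ≤ |(p n 0 : ℝ) +
      p n 1 * zetaValue 3 + p n 2 * zetaValue 5 + p n 3 * zetaValue 7|)
    (hmargin : Q + σ₁ < 2 * σ₂) :
    Irrational (zetaValue 5) ∨ Irrational (zetaValue 7) := by
  set θ : Fin 4 → ℝ := ![(1 : ℝ), zetaValue 3, zetaValue 5, zetaValue 7] with hθ
  have hsum : ∀ n : ℕ, ∑ j, (p n j : ℝ) * θ j =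
      (p n 0 : ℝ) + p n 1 * zetaValue 3 + p n 2 * zetaValue 5 + p n 3 * zetaValue 7 := by
    intro n
    simp [hθ, Fin.sum_univ_four]
  have hup' : ∀ s : ℝ, s < σ₂ → ∀ᶠ n : ℕ in atTop,
      |∑ j, (p n j : ℝ) * θ j| ≤ Real.exp (-(s * n)) :=
    fun s hs => (hup s hs).mono fun n hn => by rwa [hsum n]
  have hlow' : ∀ s : ℝ, σ₁ < s → ∀ᶠ n : ℕ in atTop,
      Real.exp (-(s * n)) ≤ |∑ j, (p n j : ℝ) * θ j| :=
    fun s hs => (hlow s hs).mono fun n hn => by rwa [hsum n]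
  obtain ⟨s, hcard, hs⟩ := exists_finset_irrational_of_nesterenko_brackets θ 0 (by simp [hθ]) p
    hσ₂ hσ₁₂ hQ hp hup' hlow' 1 (by push_cast; linarith)
  exact zetaFiveOrSeven_of_finset s hcard (by simpa [hθ] using hs)

/-! ### Instances, `s = 9`: forms in `1, ζ(3), ζ(5), ζ(7), ζ(9)` -/

/-- **One of `ζ(5), ζ(7), ζ(9)` from five-term forms (exact rate).** Integer forms
`L_n = p n 0 + p n 1 ζ(3) + p n 2 ζ(5) + p n 3 ζ(7) + p n 4 ζ(9)` of EXACT size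
`|L_n|^{1/n} → e^{-σ}` with coefficients `≤ e^{Q' n}` (all `Q' > Q > 0`) and margin `Q < σ`: then
two of `ζ(3), …, ζ(9)` are irrational, hence at least one of `ζ(5), ζ(7), ζ(9)` — which would
improve the tree's `zudilin` (one of `ζ(5), …, ζ(11)`). Implication only. -/
theorem zetaFiveSevenNine_of_fiveTermForms (p : ℕ → Fin 5 → ℤ) {σ Q : ℝ} (hσ : 0 < σ)
    (hQ : 0 < Q)
    (hp : ∀ Q' : ℝ, Q < Q' → ∀ᶠ n : ℕ in atTop, ∀ j, |(p n j : ℝ)| ≤ Real.exp (Q' * n))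
    (hℓ : Tendsto (fun n : ℕ => |(p n 0 : ℝ) + p n 1 * zetaValue 3 + p n 2 * zetaValue 5 +
      p n 3 * zetaValue 7 + p n 4 * zetaValue 9| ^ (1 / (n : ℝ))) atTop (𝓝 (Real.exp (-σ))))
    (hmargin : Q < σ) :
    Irrational (zetaValue 5) ∨ Irrational (zetaValue 7) ∨ Irrational (zetaValue 9) := by
  set θ : Fin 5 → ℝ := ![(1 : ℝ), zetaValue 3, zetaValue 5, zetaValue 7, zetaValue 9] with hθ
  have hsum : ∀ n : ℕ, ∑ j, (p n j : ℝ) * θ j = (p n 0 : ℝ) + p n 1 * zetaValue 3 +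
      p n 2 * zetaValue 5 + p n 3 * zetaValue 7 + p n 4 * zetaValue 9 := by
    intro n
    simp [hθ, Fin.sum_univ_five]
  have hℓ' : Tendsto (fun n : ℕ => |∑ j, (p n j : ℝ) * θ j| ^ (1 / (n : ℝ))) atTop
      (𝓝 (Real.exp (-σ))) := hℓ.congr fun n => by rw [hsum n]
  obtain ⟨s, hcard, hs⟩ := exists_finset_irrational_of_nesterenko_margin θ 0 (by simp [hθ]) p
    hσ hQ hp hℓ' 1 (by simpa using hmargin)
  by_contra hcon
  push Not at hcon
  have hsub : s ⊆ {1} := by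
    intro j hj
    have hj' := hs j hj
    fin_cases j
    · simp [hθ] at hj'
    · simp
    · exact absurd (by simpa [hθ] using hj') hcon.1
    · exact absurd (by simpa [hθ] using hj') hcon.2.1
    · exact absurd (by simpa [hθ] using hj') hcon.2.2
  have h := card_le_card hsub
  rw [card_singleton] at h
  omega

/-- **Two of `ζ(5), ζ(7), ζ(9)` from five-term forms (exact rate), margin `2 Q < σ`.** With the
stronger partial margin `2 Q < σ` the same forms give `dim ≥ 4`, so three of `ζ(3), …, ζ(9)` are
irrational, hence at least two of `ζ(5), ζ(7), ζ(9)`. Implication only. -/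
theorem twoOf_zetaFiveSevenNine_of_fiveTermForms (p : ℕ → Fin 5 → ℤ) {σ Q : ℝ} (hσ : 0 < σ)
    (hQ : 0 < Q)
    (hp : ∀ Q' : ℝ, Q < Q' → ∀ᶠ n : ℕ in atTop, ∀ j, |(p n j : ℝ)| ≤ Real.exp (Q' * n))
    (hℓ : Tendsto (fun n : ℕ => |(p n 0 : ℝ) + p n 1 * zetaValue 3 + p n 2 * zetaValue 5 +
      p n 3 * zetaValue 7 + p n 4 * zetaValue 9| ^ (1 / (n : ℝ))) atTop (𝓝 (Real.exp (-σ))))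
    (hmargin : 2 * Q < σ) :
    (Irrational (zetaValue 5) ∧ Irrational (zetaValue 7)) ∨
      (Irrational (zetaValue 5) ∧ Irrational (zetaValue 9)) ∨
      (Irrational (zetaValue 7) ∧ Irrational (zetaValue 9)) := by
  classical
  set θ : Fin 5 → ℝ := ![(1 : ℝ), zetaValue 3, zetaValue 5, zetaValue 7, zetaValue 9] with hθ
  have hsum : ∀ n : ℕ, ∑ j, (p n j : ℝ) * θ j = (p n 0 : ℝ) + p n 1 * zetaValue 3 +
      p n 2 * zetaValue 5 + p n 3 * zetaValue 7 + p n 4 * zetaValue 9 := by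
    intro n
    simp [hθ, Fin.sum_univ_five]
  have hℓ' : Tendsto (fun n : ℕ => |∑ j, (p n j : ℝ) * θ j| ^ (1 / (n : ℝ))) atTop
      (𝓝 (Real.exp (-σ))) := hℓ.congr fun n => by rw [hsum n]
  obtain ⟨s, hcard, hs⟩ := exists_finset_irrational_of_nesterenko_margin θ 0 (by simp [hθ]) p
    hσ hQ hp hℓ' 2 (by simpa using hmargin)
  -- `0 ∉ s`; unless two of `2, 3, 4` lie in `s`, `s ⊆ {1, j}` has at most two elements
  have h0 : (0 : Fin 5) ∉ s := fun h => by simpa [hθ] using hs 0 h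
  have hirr : ∀ j ∈ s, Irrational (θ j) := hs
  have card_le_two : ∀ j : Fin 5, s ⊆ ({1, j} : Finset (Fin 5)) → False := by
    intro j hsub
    have h := card_le_card hsub
    have h' : (({1, j} : Finset (Fin 5))).card ≤ 2 := card_insert_le _ _
    omega
  by_cases h2 : (2 : Fin 5) ∈ s <;> by_cases h3 : (3 : Fin 5) ∈ s <;>
    by_cases h4 : (4 : Fin 5) ∈ s
  · exact Or.inl ⟨by simpa [hθ] using hirr 2 h2, by simpa [hθ] using hirr 3 h3⟩
  · exact Or.inl ⟨by simpa [hθ] using hirr 2 h2, by simpa [hθ] using hirr 3 h3⟩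
  · exact Or.inr (Or.inl ⟨by simpa [hθ] using hirr 2 h2, by simpa [hθ] using hirr 4 h4⟩)
  · exact (card_le_two 2 fun j hj => by fin_cases j <;> simp_all).elim
  · exact Or.inr (Or.inr ⟨by simpa [hθ] using hirr 3 h3, by simpa [hθ] using hirr 4 h4⟩)
  · exact (card_le_two 3 fun j hj => by fin_cases j <;> simp_all).elim
  · exact (card_le_two 4 fun j hj => by fin_cases j <;> simp_all).elim
  · exact (card_le_two 1 fun j hj => by fin_cases j <;> simp_all).elim

end Summit.KontsevichZagierPeriods.Zeta5Search
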